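import Summits.ResolutionOfSingularities.ResolutionOfSingularities.Theorems.PurelyInseparableDim4ChartAtlasSNCFarRepairCentre
import Summits.ResolutionOfSingularities.ResolutionOfSingularities.Theorems.PurelyInseparableDim4ChartAtlasSNCGoodFarEscaping
import Summits.ResolutionOfSingularities.ResolutionOfSingularities.Theorems.PurelyInseparableDim4ChartAtlasSNCLocalBaseOffCentre
import Summits.ResolutionOfSingularities.ResolutionOfSingularities.Theorems.PurelyInseparableDim4ChartAtlasCover
import HarnessLib

/-!
# Purely inseparable four-folds `z^p + F(x₁, …, x₄)`: THE FAR-RESONANCE REPAIR ON `W` — after ONE blow-up along the repair centre `C_W` the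
# strict transform of the escaping global centre `Zc` is admissible (cell `res-dim4-pi`, typ-2 g7; HANDOFF OPEN 4 «transport of the far
# repair to the walk's stage objects», W-level, escaping case `j ∉ S'`; the resonant counterpart of the far positive p704073)

[OURS · counted 0] (D-0157 DOOR 2; DR-157-C.) Setting of p704073 / PK p704887 (`π : W → 𝔸⁵` ANY blowing up along `V(z, x_S)`, chart `j ∈ S`,
`b_j = 0`, re-centring `Θⱼ` of record with `z^p + F ↦ x_j^p (z^p + F₁)`, `F ≠ 0` clean `S`-permissible, `F₁` `S'`-permissible, `j ∉ S'`, `S' ≠ ∅`,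
near/far boundary `ms/c`, `fs/d`, `M′ = ((z^p + F)·𝒪, E, p).transform π 𝓘Λ_S`, `Zc = 𝓘(closure φⱼ V(z, x_{S'}))`). p704073 proved: `Zc` is snc
with `M′.boundary` when `|B_near| ≤ 1` (hB1/hB2) and NO two active far members share a height (hH1/hH2). HERE the far heights may COINCIDE at the
non-zero heights of a list `hs` (hH1/hH2 are asked only for members whose heights avoid `hs`): with the repair centre `C_W` of
`…SNCFarRepairCentre` (admissible for `M′`), PROVED (no `sorry`, no new axiom):

* `forall_mem_transform_boundary_comap_chart_nearFar` — the transformed near/far boundary read on the re-centred `x_j`-chart is in the natural-frame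
  alphabet (hyperplanes; far quadrics `((yᵢ + bᵢ)·y_j − 0·yᵢ + dᵢ)`; p699206 §3 / p703421);
* **`admissible_strictTransform_after_farRepairW`** — for ANY blowing up `τ : W″ → W` along `C_W`: `C' = St_τ(Zc)` is REGULAR,
  `V(C') ⊆ supp(M′.transform τ C_W)`, and `HasSNCWith (M′.transform τ C_W).boundary C'` — the strict transform of the escaping centre is an
  ADMISSIBLE centre after the ONE extra blow-up. Assembly: p719344 `admissible_strictTransform_of_model_offCentre` with the MODEL = p718376
  `admissible_strictTransform_after_manyHeights_farRepair` at `c′ = 0` on the `x_j`-chart (`φⱼ^*C_W = C(hs)`, `φⱼ^*Zc = 𝓘Λ_{S'}`,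
  `φⱼ^*M′.ideal = (z^p + F₁)·𝒪`), and OFF THE CENTRE = p704073 for the REDUCED far list (members at the heights of `hs` removed; they meet `Zc`
  only inside `V(C_W)`: over `{xᵢ = −dᵢ}` a point lies in the `xᵢ`-chart, points of `Zc` there lie in the `x_j`-chart (p688180's absorption), and
  on the `x_j`-chart an active quadric meets `V(y_0, y_{S'})` only at its height).

WORDS: «on W, in the escaping case: |B_near| ≤ 1 ⟹ after at most ONE extra blow-up (along the disjoint union of the far-resonance loci, a regular
centre inside Zc, snc with the boundary) the strict transform of the escaping global centre is admissible» — S3-N2's far side COMPLETE on W ‖ K.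
Nothing here is a statement about resolution of singularities in dimension ≥ 4 / characteristic `p` (NOT proved anywhere in this programme).
bears_on: LADDER-RESOLUTION:D157-DOOR2 (res-dim4-pi). Supports stmt-ResolutionOfSingularities-16155 (helper).
-/

-- every declaration of this summit lives under `Summit.ResolutionOfSingularities.ResolutionOfSingularities`
-- (summit = problem), which the duplicate-namespace linter flags; house convention (cf. the Target file).
set_option linter.dupNamespace false

noncomputable section

open MvPolynomial CategoryTheory AlgebraicGeometry Opposite TopologicalSpace
open AlgebraicGeometry.Scheme.IdealSheafData (ofIdealTop vanishingIdeal)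

namespace Summit.ResolutionOfSingularities.ResolutionOfSingularities.Theorems.PIDim4

open Literature.AlgebraicGeometry.Resolution
open Literature.AlgebraicGeometry.Resolution.Hauser2010
open Literature.AlgebraicGeometry.Resolution.AffinePointBlowup (P A γ coord Wtop ξ)
open Literature.Barriers.ResolutionOfSingularities

namespace ChartDictionary

variable {K : Type} [Field K] {p : ℕ} [hp : Fact p.Prime] [CharP K p]
  {S S' : Finset (Fin 4)} {j : Fin 4} {b : Fin 4 → K} {Θⱼ : A 4 K ≃ₐ[K] A 4 K} {h : MvPolynomial (Fin 4) K}
  {F F₁ : MvPolynomial (Fin 4) K} {W : Scheme.{0}} {π : W ⟶ P 4 K}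

/-! ## §1 The transformed near/far boundary read on the `x_j`-chart -/

/-- **The transformed near/far boundary, read on the re-centred `x_j`-chart, is in the natural-frame alphabet**: `⊤`, hyperplanes `(m, a) ∈ H`
(`E₁ ↦ (j⁺, 0)`, near `i ∈ ms ↦ (i⁺, bᵢ + cᵢ)`, far of index `j ↦ (j⁺, d_j)`), and far quadrics `((yᵢ + bᵢ)·y_j − 0·yᵢ + dᵢ)`, `i ∈ fs ∖ j`
(the readings of p699206 §3 / p703421, packaged). -/
theorem forall_mem_transform_boundary_comap_chart_nearFar [DecidableEq (Fin 4)] (hj : j ∈ S) (hbj : b j = 0)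
    (hsj : ∀ i : Fin 4, Θⱼ (X i.succ) = X i.succ + C (b i))
    (hπ : IsBlowup π (AffineCoordBlowup.𝓘Λ 4 K (insert 0 (Fin.succ '' (S : Set (Fin 4)))))) (ms fs : List (Fin 4)) (c d : Fin 4 → K)
    (hc : ∀ i ∈ S, c i = 0) (hfs : ∀ i ∈ fs, i ∈ S ∧ d i ≠ 0) (H : Finset (Fin (4 + 1) × K))
    (hHmem : ∀ ka, ka ∈ H ↔ ka = (j.succ, (0 : K)) ∨ (∃ i ∈ ms, ka = (i.succ, b i + c i)) ∨ (j ∈ fs ∧ ka = (j.succ, d j))) :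
    haveI : IsIso (CommRingCat.ofHom (Θⱼ : A 4 K →+* A 4 K)) := (inferInstance : IsIso Θⱼ.toRingEquiv.toCommRingCatIso.hom)
    ∀ D ∈ ((((ms.map fun i => ofIdealTop (Ideal.span {(γ 4 K).symm (X i.succ + C (c i))})) ++
          fs.map fun i => ofIdealTop (Ideal.span {(γ 4 K).symm (X i.succ + C (d i))})).map
          (strictTransformIdeal π (AffineCoordBlowup.𝓘Λ 4 K (insert 0 (Fin.succ '' (S : Set (Fin 4)))))) ++
        [(AffineCoordBlowup.𝓘Λ 4 K (insert 0 (Fin.succ '' (S : Set (Fin 4))))).comap π]).map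
        (·.comap (Spec.map (CommRingCat.ofHom (Θⱼ : A 4 K →+* A 4 K)) ≫ AffineCoordBlowup.chartImm hπ (succ_mem_centreVars hj)))),
      D = ⊤ ∨ (∃ ma ∈ H, D = ofIdealTop (Ideal.span {(γ 4 K).symm (X ma.1 + C ma.2)})) ∨
        ∃ k ∈ fs.toFinset.erase j, D = ofIdealTop (Ideal.span {(γ 4 K).symm
          ((X k.succ + C (b k)) * X j.succ - C (0 : K) * X k.succ + C (d k))}) := by
  haveI : IsIso (CommRingCat.ofHom (Θⱼ : A 4 K →+* A 4 K)) := (inferInstance : IsIso Θⱼ.toRingEquiv.toCommRingCatIso.hom)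
  intro D hD
  rw [List.map_append, List.map_map, List.mem_append, List.mem_map, List.map_singleton, List.mem_singleton] at hD
  rcases hD with ⟨D₀, hD₀, rfl⟩ | rfl
  · rcases List.mem_append.mp hD₀ with hD₀ | hD₀
    · -- near members
      obtain ⟨i, hi, rfl⟩ := List.mem_map.mp hD₀
      simp only [Function.comp_apply]
      by_cases hij : i = j
      · subst hij
        left
        rw [hc i hj, C_0, add_zero, Scheme.IdealSheafData.comap_comp,
          show (γ 4 K).symm (X i.succ) = coord 4 K i.succ from rfl, strictTransformIdeal_hyperplane_self_comap_chartImm hj hπ,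
          Scheme.IdealSheafData.comap_top]
      · right; left
        refine ⟨(i.succ, b i + c i), (hHmem _).mpr (Or.inr (Or.inl ⟨i, hi, rfl⟩)), ?_⟩
        rw [Scheme.IdealSheafData.comap_comp]
        by_cases hiS : i ∈ S
        · rw [hc i hiS, C_0, add_zero, add_zero, show (γ 4 K).symm (X i.succ) = coord 4 K i.succ from rfl,
            strictTransformIdeal_hyperplane_comap_chartImm hj hij hπ,
            show coord 4 K i.succ = (γ 4 K).symm (X i.succ) from rfl, comap_ofIdealTop_span_γ_symm, RingHom.coe_coe, hsj i]
        · have hC : Θⱼ (C (c i)) = C (c i) := Θⱼ.commutes (c i)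
          rw [strictTransformIdeal_translate_comap_chartImm hj hiS (c i) hπ, comap_ofIdealTop_span_γ_symm, RingHom.coe_coe,
            map_add, hsj i, hC, add_assoc, ← C_add]
    · -- far members
      obtain ⟨i, hi, rfl⟩ := List.mem_map.mp hD₀
      obtain ⟨hiS, hdi⟩ := hfs i hi
      simp only [Function.comp_apply]
      by_cases hij : i = j
      · subst hij
        right; left
        refine ⟨(i.succ, d i), (hHmem _).mpr (Or.inr (Or.inr ⟨hi, rfl⟩)), ?_⟩
        rw [comap_recenter_chart_strictTransform_far_self hj hdi hsj hπ, hbj, zero_add]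
      · right; right
        refine ⟨i, Finset.mem_erase.mpr ⟨hij, List.mem_toFinset.mpr hi⟩, ?_⟩
        rw [comap_recenter_chart_strictTransform_far hj hiS hij hdi hsj hπ, hbj, C_0, add_zero, zero_mul, sub_zero]
  · -- the exceptional component
    right; left
    refine ⟨(j.succ, 0), (hHmem _).mpr (Or.inl rfl), ?_⟩
    rw [Scheme.IdealSheafData.comap_comp, comap_𝓘Λ_chartImm hj hπ, show coord 4 K j.succ = (γ 4 K).symm (X j.succ) from rfl,
      comap_ofIdealTop_span_γ_symm, RingHom.coe_coe, hsj j, hbj]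

/-! ## §2 The far repair on `W` -/

/-- **THE FAR-RESONANCE REPAIR ON `W` (escaping case `j ∉ S'`, `S' ≠ ∅`).** Setting of p704073 with `|B_near| ≤ 1` (hB1/hB2); `hs` a nodup list
of NON-ZERO heights; the far height conditions are asked only OFF `hs`: `hH1` (an active quadric `i` and the index-`j` far hyperplane, when
`−d_j ∉ hs` and the height of `i` is not in `hs`) and `hH2` (two active quadrics whose heights avoid `hs`). With the repair centre
`C_W = 𝓘(closure φⱼ(V(C(hs))))` of `…SNCFarRepairCentre`: for ANY blowing up `τ : W″ → W` along `C_W`, `St_τ(Zc)` is REGULAR, inside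
`supp(M′.transform τ C_W)`, and snc with `(M′.transform τ C_W).boundary`. -/
theorem admissible_strictTransform_after_farRepairW [IsAlgClosed K] (hj : j ∈ S) (hjS' : j ∉ S') (hbj : b j = 0) (hF : F ≠ 0)
    (hclean : HauserPerlega.IsClean p F) (h0j : Θⱼ (X 0) = X 0 + rename Fin.succ h) (hsj : ∀ i : Fin 4, Θⱼ (X i.succ) = X i.succ + C (b i))
    (hπ : IsBlowup π (AffineCoordBlowup.𝓘Λ 4 K (insert 0 (Fin.succ '' (S : Set (Fin 4))))))
    (hperm : (p : ℕ∞) ≤ CentreBlowup.ordAlong S F)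
    (hread : Θⱼ (coordBlowupSubst K (insert 0 (Fin.succ '' (S : Set (Fin 4)))) j.succ (hyp p F)) = X j.succ ^ p * hyp p F₁)
    (hperm' : (p : ℕ∞) ≤ CentreBlowup.ordAlong S' F₁) (ms fs : List (Fin 4)) (c d : Fin 4 → K) (hc : ∀ i ∈ S, c i = 0)
    (hfs : ∀ i ∈ fs, i ∈ S ∧ d i ≠ 0) (hdis : ∀ i ∈ fs, i ∉ ms)
    (hB1 : j ∈ ms → ∀ m ∈ ms, m ∈ S → m ∈ S' → b m = 0)
    (hB2 : ∀ m ∈ ms, ∀ m' ∈ ms, m ∈ S → m' ∈ S → m ∈ S' → m' ∈ S' → b m ≠ 0 → b m' ≠ 0 → m = m')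
    (hs : List K) (hne : hs ≠ []) (hnd : hs.Nodup) (h0 : ∀ h' ∈ hs, h' ≠ 0)
    (hH1 : ∀ i ∈ fs, i ∈ S' → b i ≠ 0 → j ∈ fs → (∀ h' ∈ hs, d j + h' ≠ 0) → (∀ h' ∈ hs, d i + b i * h' ≠ 0) → d i ≠ b i * d j)
    (hH2 : ∀ i ∈ fs, ∀ k ∈ fs, i ≠ k → i ∈ S' → k ∈ S' → b i ≠ 0 → b k ≠ 0 → (∀ h' ∈ hs, d i + b i * h' ≠ 0) →
      (∀ h' ∈ hs, d k + b k * h' ≠ 0) → d i * b k ≠ d k * b i)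
    {k₀ : Fin 4} (hk₀ : k₀ ∈ S') :
    haveI : IsIso (CommRingCat.ofHom (Θⱼ : A 4 K →+* A 4 K)) := (inferInstance : IsIso Θⱼ.toRingEquiv.toCommRingCatIso.hom)
    let φⱼ := Spec.map (CommRingCat.ofHom (Θⱼ : A 4 K →+* A 4 K)) ≫ AffineCoordBlowup.chartImm hπ (succ_mem_centreVars hj)
    let Zc := vanishingIdeal (closureImage φⱼ ((AffineCoordBlowup.𝓘Λ 4 K (insert 0 (Fin.succ '' (S' : Set (Fin 4))))).support : Set (P 4 K)))
    let M' := ((⟨hypSheaf p F, (ms.map fun i => ofIdealTop (Ideal.span {(γ 4 K).symm (X i.succ + C (c i))})) ++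
        fs.map fun i => ofIdealTop (Ideal.span {(γ 4 K).symm (X i.succ + C (d i))}), p⟩ :
        MarkedIdeal (P 4 K)).transform π (AffineCoordBlowup.𝓘Λ 4 K (insert 0 (Fin.succ '' (S : Set (Fin 4))))))
    let Cmod := (hs.map fun h' => (AffineCoordBlowup.𝓘Λ 4 K (insert 0 (Fin.succ '' ((insert j S' : Finset (Fin 4)) : Set (Fin 4))))).comap
      (Spec.map (CommRingCat.ofHom ((AffinePointBlowup.translateEquiv (n := 4) (Pi.single j.succ (-h')) : A 4 K ≃ₐ[K] A 4 K) :
        A 4 K →+* A 4 K)))).prod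
    let CW := vanishingIdeal (closureImage φⱼ (Cmod.support : Set (P 4 K)))
    ∀ ⦃W'' : Scheme.{0}⦄ ⦃τ : W'' ⟶ W⦄, IsBlowup τ CW →
      Scheme.IsRegular (strictTransformIdeal τ CW Zc).subscheme ∧
        ((strictTransformIdeal τ CW Zc).support : Set W'') ⊆ (M'.transform τ CW).support ∧
        HasSNCWith (M'.transform τ CW).boundary (strictTransformIdeal τ CW Zc) := by
  intro φⱼ Zc M' Cmod CW W'' τ hτ
  classical
  haveI hisoj : IsIso (CommRingCat.ofHom (Θⱼ : A 4 K →+* A 4 K)) := (inferInstance : IsIso Θⱼ.toRingEquiv.toCommRingCatIso.hom)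
  haveI : IsOpenImmersion φⱼ := inferInstanceAs (IsOpenImmersion
    (Spec.map (CommRingCat.ofHom (Θⱼ : A 4 K →+* A 4 K)) ≫ AffineCoordBlowup.chartImm hπ (succ_mem_centreVars hj)))
  haveI : IsProper π := hπ.isProper
  haveI : IsLocallyNoetherian W := LocallyOfFiniteType.isLocallyNoetherian π
  set Λ : Set (Fin (4 + 1)) := insert 0 (Fin.succ '' (S : Set (Fin 4))) with hΛ
  set E : List (Scheme.IdealSheafData (P 4 K)) :=
    (ms.map fun i => ofIdealTop (Ideal.span {(γ 4 K).symm (X i.succ + C (c i))})) ++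
      fs.map fun i => ofIdealTop (Ideal.span {(γ 4 K).symm (X i.succ + C (d i))}) with hEdef
  -- the repair centre package
  obtain ⟨hcomap, hrange, -, -, -, hsncC⟩ := farRepairCentre_package hj hjS' hbj h0j hsj hπ hperm hread hperm' ms fs c d hc hfs hdis
    hs hne hnd h0
  -- the hyperplane data of the chart readings
  let H : Finset (Fin (4 + 1) × K) :=
    insert (j.succ, (0 : K)) (ms.toFinset.image (fun i => (i.succ, b i + c i)) ∪ (if j ∈ fs then {(j.succ, d j)} else ∅))
  have hHmem : ∀ ka, ka ∈ H ↔ ka = (j.succ, (0 : K)) ∨ (∃ i ∈ ms, ka = (i.succ, b i + c i)) ∨ (j ∈ fs ∧ ka = (j.succ, d j)) := by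
    intro ka
    simp only [H, Finset.mem_insert, Finset.mem_union, Finset.mem_image, List.mem_toFinset]
    refine or_congr Iff.rfl (or_congr ⟨fun ⟨i, hi, e⟩ => ⟨i, hi, e.symm⟩, fun ⟨i, hi, e⟩ => ⟨i, hi, e.symm⟩⟩ ?_)
    by_cases hjfs : j ∈ fs
    · rw [if_pos hjfs, Finset.mem_singleton]; exact ⟨fun h => ⟨hjfs, h⟩, fun h => h.2⟩
    · rw [if_neg hjfs]; exact ⟨fun h => absurd h (Finset.notMem_empty _), fun h => absurd h.1 hjfs⟩
  have hEshape := forall_mem_transform_boundary_comap_chart_nearFar hj hbj hsj hπ ms fs c d hc hfs H hHmem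
  -- the reduced far list: members at the heights of `hs` removed
  let bad : Fin 4 → Prop := fun i => (i ∈ S' ∧ ∃ h' ∈ hs, d i + b i * h' = 0) ∨ (i = j ∧ ∃ h' ∈ hs, d j + h' = 0)
  set fsr : List (Fin 4) := fs.filter fun i => decide (¬ bad i) with hfsr
  have hfsr_mem : ∀ i, i ∈ fsr ↔ i ∈ fs ∧ ¬ bad i := fun i => by
    rw [hfsr, List.mem_filter, decide_eq_true_iff]
  -- off the centre: the far positive p704073 for the reduced list
  have hZsnc : HasSNCWith (((ms.map fun i => ofIdealTop (Ideal.span {(γ 4 K).symm (X i.succ + C (c i))})) ++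
      fsr.map fun i => ofIdealTop (Ideal.span {(γ 4 K).symm (X i.succ + C (d i))})).map
      (strictTransformIdeal π (AffineCoordBlowup.𝓘Λ 4 K Λ)) ++ [(AffineCoordBlowup.𝓘Λ 4 K Λ).comap π]) Zc := by
    have hW := hasSNCWith_transform_boundary_globalCentre_of_far_heights hj hjS' hbj hF hclean h0j hsj hπ hperm hread hperm' ms fsr c d hc
      (fun i hi => hfs i ((hfsr_mem i).mp hi).1) (fun i hi => hdis i ((hfsr_mem i).mp hi).1) hB1 hB2 ?_ ?_
    · rw [MarkedIdeal.transform_boundary] at hW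
      exact hW
    · intro i hi hiS' hbi hjr
      obtain ⟨hifs, hnb⟩ := (hfsr_mem i).mp hi
      obtain ⟨hjfs, hnbj⟩ := (hfsr_mem j).mp hjr
      refine hH1 i hifs hiS' hbi hjfs (fun h' hh' hc' => hnbj (Or.inr ⟨rfl, h', hh', hc'⟩)) fun h' hh' hc' => hnb (Or.inl ⟨hiS', h', hh', hc'⟩)
    · intro i hi k hk hik hiS' hkS' hbi hbk
      obtain ⟨hifs, hnbi⟩ := (hfsr_mem i).mp hi
      obtain ⟨hkfs, hnbk⟩ := (hfsr_mem k).mp hk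
      exact hH2 i hifs k hkfs hik hiS' hkS' hbi hbk (fun h' hh' hc' => hnbi (Or.inl ⟨hiS', h', hh', hc'⟩))
        fun h' hh' hc' => hnbk (Or.inl ⟨hkS', h', hh', hc'⟩)
  refine admissible_strictTransform_of_model_offCentre φⱼ M' hrange hsncC ?_
    (isRegular_globalCentre_of_reading hj hbj h0j hsj hπ hperm hread hperm')
    (support_globalCentre_subset_support_transform_of_reading hj hbj h0j hsj hπ hperm hread hperm' _ rfl rfl) hZsnc ?_ hτ
  · -- THE MODEL: the many-heights repair on the `x_j`-chart (c′ = 0)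
    intro V' τV hτV
    have hideal : M'.ideal.comap φⱼ = hypSheaf p F₁ := comap_chart_transform_ideal_of_reading hj hbj h0j hsj hπ hperm hread _ rfl rfl
    have hZc : Zc.comap φⱼ = AffineCoordBlowup.𝓘Λ 4 K (insert 0 (Fin.succ '' (S' : Set (Fin 4)))) := comap_globalCentre _ _
    have hmult : M'.mult = p := rfl
    rw [hcomap] at hτV ⊢
    rw [hZc, hideal, hmult]
    refine admissible_strictTransform_after_manyHeights_farRepair (b := b) (e := d) (c' := 0) hjS' hs hne hnd
      (fun h' hh' => by rw [zero_sub, neg_ne_zero]; exact h0 h' hh') H (fs.toFinset.erase j) (Finset.notMem_erase j _)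
      (fun i hi => by rw [mul_zero, add_zero]; exact (hfs i (List.mem_toFinset.mp (Finset.mem_of_mem_erase hi))).2) ?_ ?_ ?_ hk₀ ?_
      F₁ hperm' rfl hτV
    · -- (C1) a hyperplane of a quadric's index is the near member of that index
      intro i hi a ha
      rcases (hHmem _).mp ha with e | ⟨i', hi', e⟩ | ⟨-, e⟩
      · exact absurd (Fin.succ_injective _ (Prod.mk.inj e).1) (Finset.ne_of_mem_erase hi)
      · obtain ⟨e1, e2⟩ := Prod.mk.inj e
        have hii' : i = i' := Fin.succ_injective _ e1
        subst hii'
        rw [e2, hc i (hfs i (List.mem_toFinset.mp (Finset.mem_of_mem_erase hi))).1, add_zero]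
      · exact absurd (Fin.succ_injective _ (Prod.mk.inj e).1) (Finset.ne_of_mem_erase hi)
    · -- index-`j` hyperplanes vs active quadrics, off the heights `hs`
      intro a ha hah k hk hkS' hdk hbk
      have hkfs : k ∈ fs := List.mem_toFinset.mp (Finset.mem_of_mem_erase hk)
      rcases (hHmem _).mp ha with e | ⟨i', hi', e⟩ | ⟨hjfs, e⟩
      · rw [(Prod.mk.inj e).2, zero_mul]; exact (hfs k hkfs).2
      · obtain ⟨e1, e2⟩ := Prod.mk.inj e
        have hji' : j = i' := Fin.succ_injective _ e1
        subst hji'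
        rw [e2, hbj, hc j hj, add_zero, zero_mul]; exact (hfs k hkfs).2
      · rw [(Prod.mk.inj e).2] at hah ⊢
        rw [mul_comm]
        exact hH1 k hkfs hkS' hbk hjfs hah hdk
    · -- two active quadrics, off the heights `hs`
      intro k hk k' hk' hkS' hk'S' hdk hdk' hkk hbk hbk'
      exact hH2 k (List.mem_toFinset.mp (Finset.mem_of_mem_erase hk)) k' (List.mem_toFinset.mp (Finset.mem_of_mem_erase hk')) hkk
        hkS' hk'S' hbk hbk' hdk hdk'
    · -- the readings
      rw [MarkedIdeal.transform_boundary]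
      exact hEshape
  · -- THE REMOVED MEMBERS MEET `Zc` ONLY INSIDE `V(C_W)`
    intro D hD hDE₀ w hw
    rw [MarkedIdeal.transform_boundary] at hD
    rw [List.mem_append, List.mem_map] at hD hDE₀
    obtain ⟨hwD, hwZ⟩ := hw
    -- `D` is the strict transform of a far member `i ∈ fs ∖ fsr`
    have hfar : ∃ i ∈ fs, bad i ∧ D = strictTransformIdeal π (AffineCoordBlowup.𝓘Λ 4 K Λ)
        (ofIdealTop (Ideal.span {(γ 4 K).symm (X i.succ + C (d i))})) := by
      rcases hD with ⟨D₀, hD₀, rfl⟩ | hD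
      · rcases List.mem_append.mp hD₀ with hD₀ | hD₀
        · exact absurd (Or.inl ⟨D₀, List.mem_append.mpr (Or.inl hD₀), rfl⟩) hDE₀
        · obtain ⟨i, hi, rfl⟩ := List.mem_map.mp hD₀
          by_cases hbi : bad i
          · exact ⟨i, hi, hbi, rfl⟩
          · exact absurd (Or.inl ⟨_, List.mem_append.mpr (Or.inr (List.mem_map.mpr ⟨i, (hfsr_mem i).mpr ⟨hi, hbi⟩, rfl⟩)), rfl⟩) hDE₀
      · exact absurd (Or.inr hD) hDE₀
    obtain ⟨i, hifs, hbi, rfl⟩ := hfar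
    obtain ⟨hiS, hdi⟩ := hfs i hifs
    -- the point lies over `{xᵢ = −dᵢ}`, hence in the `xᵢ`-chart
    have hπw : (X i.succ + C (d i) : A 4 K) ∈ (π w).asIdeal :=
      (mem_support_ofIdealTop_span_γ_symm_iff _ _).mp (mem_support_of_mem_support_strictTransformIdeal hwD)
    have hXi : (X i.succ : A 4 K) ∉ (π w).asIdeal := fun hX => by
      have h1 := (π w).asIdeal.sub_mem hπw hX
      rw [add_sub_cancel_left, C_mem_asIdeal_iff] at h1
      exact hdi h1
    -- … and in the `x_j`-chart
    have hwj : w ∈ Set.range φⱼ := by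
      change w ∈ Set.range (Spec.map (CommRingCat.ofHom (Θⱼ : A 4 K →+* A 4 K)) ≫ AffineCoordBlowup.chartImm hπ (succ_mem_centreVars hj))
      rw [range_specMap_comp_chartImm]
      by_cases hij : i = j
      · subst hij
        exact mem_opensRange_chartImm_of_X_not_mem hπ (succ_mem_centreVars hj) hXi
      · have hiS' : i ∈ S' := by
          rcases hbi with ⟨hiS', -⟩ | ⟨hij', -⟩
          · exact hiS'
          · exact absurd hij' hij
        have hwi := mem_opensRange_chartImm_of_X_not_mem hπ (succ_mem_centreVars hiS) hXi
        obtain ⟨Htw, hHtw⟩ := exists_lift_twist hj hbj h0j hsj hperm hread hperm'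
        have hZeq := strictTransformIdeal_graph_eq_globalCentre hj hjS' hbj h0j hsj hπ hHtw
        have hwZ' := hwZ
        change w ∈ (Zc.support : Set W) at hwZ'
        rw [show Zc = _ from hZeq.symm] at hwZ'
        exact support_strictTransformIdeal_graph_inter_opensRange_subset hj hjS' (Finset.mem_inter.mpr ⟨hiS', hiS⟩) hπ Htw ⟨hwZ', hwi⟩
    obtain ⟨y, rfl⟩ := hwj
    -- on the chart: the point lies on the resonance locus of the height of the member
    have hyZ : ∀ m ∈ (insert 0 (Fin.succ '' (S' : Set (Fin 4))) : Set (Fin (4 + 1))), (X m : A 4 K) ∈ y.asIdeal := by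
      have h1 : y ∈ (Zc.comap φⱼ).support := (mem_support_comap_iff _ _ y).mpr hwZ
      rw [show Zc.comap φⱼ = AffineCoordBlowup.𝓘Λ 4 K (insert 0 (Fin.succ '' (S' : Set (Fin 4)))) from comap_globalCentre _ _,
        AffineCoordBlowup.support_𝓘Λ, AffineCoordBlowup.mem_CΛ_iff'] at h1
      exact h1
    have hyD : y ∈ ((strictTransformIdeal π (AffineCoordBlowup.𝓘Λ 4 K Λ)
        (ofIdealTop (Ideal.span {(γ 4 K).symm (X i.succ + C (d i))}))).comap φⱼ).support := (mem_support_comap_iff _ _ y).mpr hwD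
    have hyj : ∃ h' ∈ hs, (X j.succ + C (-h') : A 4 K) ∈ y.asIdeal := by
      by_cases hij : i = j
      · subst hij
        rcases hbi with ⟨hiS', -⟩ | ⟨-, h', hh', hdh⟩
        · exact absurd hiS' hjS'
        · refine ⟨h', hh', ?_⟩
          change y ∈ ((strictTransformIdeal π (AffineCoordBlowup.𝓘Λ 4 K Λ) (ofIdealTop (Ideal.span {(γ 4 K).symm (X i.succ + C (d i))}))).comap
            (Spec.map (CommRingCat.ofHom (Θⱼ : A 4 K →+* A 4 K)) ≫ AffineCoordBlowup.chartImm hπ (succ_mem_centreVars hj))).support at hyD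
          rw [comap_recenter_chart_strictTransform_far_self hj hdi hsj hπ, hbj, zero_add, mem_support_ofIdealTop_span_γ_symm_iff] at hyD
          rwa [eq_neg_of_add_eq_zero_left hdh] at hyD
      · rcases hbi with ⟨hiS', h', hh', hdh⟩ | ⟨hij', -⟩
        · refine ⟨h', hh', ?_⟩
          change y ∈ ((strictTransformIdeal π (AffineCoordBlowup.𝓘Λ 4 K Λ) (ofIdealTop (Ideal.span {(γ 4 K).symm (X i.succ + C (d i))}))).comap
            (Spec.map (CommRingCat.ofHom (Θⱼ : A 4 K →+* A 4 K)) ≫ AffineCoordBlowup.chartImm hπ (succ_mem_centreVars hj))).support at hyD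
          rw [comap_recenter_chart_strictTransform_far hj hiS hij hdi hsj hπ, hbj, C_0, add_zero, mem_support_ofIdealTop_span_γ_symm_iff]
            at hyD
          have hbk : b i ≠ 0 := fun hb => hdi (by rw [hb, zero_mul, add_zero] at hdh; exact hdh)
          refine X_add_C_mem_of_tquadric_mem (b := b) (e := d) (c' := 0) y hbk hdh ?_
            (hyZ i.succ (Set.mem_insert_of_mem _ ⟨i, Finset.mem_coe.mpr hiS', rfl⟩))
          rw [C_0, zero_mul, sub_zero]
          exact hyD
        · exact absurd hij' hij
    obtain ⟨h', hh', hyj⟩ := hyj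
    -- hence `y ∈ V(C(hs))` and `φⱼ y ∈ V(C_W)`
    have hyC : y ∈ (Cmod.support : Set (P 4 K)) := by
      rw [SetLike.mem_coe, mem_support_prod_heights_iff]
      refine ⟨h', hh', ?_⟩
      rw [mem_support_comap_spec_translate_𝓘Λ_iff]
      exact X_add_C_mem_insert_of_hyperplane_mem hjS' y (-h') hyj hyZ
    show φⱼ y ∈ CW.support
    have h1 : y ∈ (CW.comap φⱼ).support := by rw [hcomap]; exact hyC
    exact (mem_support_comap_iff _ _ y).mp h1

end ChartDictionary

end Summit.ResolutionOfSingularities.ResolutionOfSingularities.Theorems.PIDim4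

end
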